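import Mathlib
import Summits.KontsevichZagierPeriods.Zeta5Search.CellKitRays
import HarnessLib

/-!
# ζ(5) search — STATEMENT FILE: Rule R2 (the DENOM-LAW track's `ν+1` law) on the A/B linear family, cell by cell (prover-d1 gen 2)

HONEST FRAMING: systematic search; no irrationality claim unless certified.  Cell `pub-zeta5`, track «DENOM-LAW» (coordinator
2026-08-23), seat `denom-prover-d1` (gen 2, ATTEMPT-3); count-neutral statement file: six NAMED `Prop`s (tagged `@[conjecture]` =
statements minted by this cell, exact evidence quoted), no theorem, no `sorry`.  They are p-adic valuation bounds for the explicit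
rationals `Cas₇(b) = W(b+e₇)V(b) − W(b)V(b+e₇)` (`CasoratianValuation.casoratian`) on an explicit two-parameter family of parameter
vectors; nothing here is a statement about ζ(5), every model exponent these feed elsewhere is `< 1`, records in print UNMOVED.

THE FAMILY.  The census's A/B directions `a_k = (k, k+2, k+2, k+1, k+4, k+8, k+10, k+5)` (A14, A15, A16, A18, B20: `k = 14, 15, 16, 18, 20`;
the rays on which engine-d2's RULE R — `HOME/denom-law/TYPE-LAW-v2.md`, typed as `DenomLaw/RuleR.lean` (`RuleR2Casoratian`, p352215) —
carries 3.1–6.1 nats/n of denominator beyond Brown–Zudilin's accounting) have the dual parameter rays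
`b = n·(3t+14; t+6, t+5, t+4, t+3, t+2, t+1, t)`, `t = k − 3`, which are the LINEAR RAYS `bLin (t n) (t n + 2n) n` of `CellKitRays`
(`b₀ = (3t+14)n`, `d = (2t+21)n`, the 21 pair blocks `b₀ − b_i − b_k = (t+i+k)n`).  In the unit cells `θ = p/n ∈ (t+c, t+c+1]`,
`c = 2,…,6`, of the first period the data of rule R2 are constant: `a = #{b_i ≥ p} = 6 − c = 4, 3, 2, 1, 0` and `N = #{blocks ≥ p} =
21, 20, 19, 17, 15` (for `c = 2,…,6`), the matching blocks `M(a)` reach `p`, and `⌊d/p⌋ = 2` once `t ≥ 15, 12, 9, 6, 3` respectively; R2's value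
`(a+4) − N` is `−13, −13, −13, −12, −11`.

WHAT IS PROVED (files `DenomLaw/RuleRABFamilyLevels.lean`, `RuleRABFamilyCell3…6.lean`, `RuleRABFamilyCell2.lean`; all `t` above a
small threshold, all `n ≥ 1`, by THEOREM LB `casoratianClassBound_holds` / the LEMMA-D BONUS `lemmaDBonus_holds` through class-type covers
whose intervals are cut by affine forms in `(t·n, n, p)`):  cells `c = 3, 4, 6` — R2's value is exactly the class bound `casLB`;
cell `c = 5` — R2's value is `casLB + 1` = the Lemma-D bonus; cell `c = 2` (the top cell, `a = 4`, all 21 blocks `≥ p`) — the class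
laws give `casLB = −15`, Lemma-D `−14`, ONE BELOW R2's `−13`.  So `RuleR2ABCell3/4/5/6` and `RuleR2ABTopCellLB` below are theorems
(`…_holds` in `RuleRABFamilyHolds.lean`), and `RuleR2ABTopCell` is the exact residual content of rule R on this family.

EVIDENCE for `RuleR2ABTopCell` (OBSERVED, exact rational arithmetic with the cell's gen-1 dual-series engine `code/gen1/dictionary.py`,
seat script `code/abfamily_topcell.py` / `topcell_small_t.py`): `v_p(Cas₇) = −13` exactly at every instance computed — `(t, n, p)` =
(8,1,11), (10,1,13), (14,1,17), (16,1,19), (20,1,23), (26,1,29), (28,1,31), (7,2,19), (9,2,23), (12,2,29), (13,2,31), (16,2,37), (18,2,41),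
(19,2,43), (21,2,47), (24,2,53), (27,2,59), (28,2,61), (7,3,29), (8,3,31), (10,3,37), (11,3,41), (12,3,43), (13,3,47), (15,3,53), (17,3,59)
(26 instances, `b₀ ≤ 196`), with `(v_p U, v_p W, v_p V) = (−4, −6, −9)` at `b` (and at `b + e₇` where computed) in every case but
`(8,1,11)` (`v_p W = −5` there) — so the truth is TWO above the termwise value `v(W) + v(V) = −15 = casLB` and one above the Lemma-D digit;
engine-d2's sealed out-of-sample score P-D2-3 (census kit j180578, `HOME/denom-law/prereg/SCORE-P-D2-2-3.md`: 0 violations, 481/481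
predicted R-cells observed, among them all 255 R-cells of A18 = `t = 15` at `n = 46..55`, which include this class) records the same `+1`,
and the census ladder probe has this class as the one R-class no proved rung reaches (`TYPE-LAW-v2.md` §3.4: "(R2, a = 4, λ = ∅) … 0/6
NOT PROVED", B20 = `t = 17`).  Below `t = 7` the cell's class structure changes (`t = 5, n = 3, p = 23`: truth `−14 = casLB + 1`), hence
the threshold.  Falsifier: one prime in the cell with `v_p(Cas₇) ≤ −14`.
-/

namespace Summit.KontsevichZagierPeriods.Zeta5Search.DenomLaw

open Summit.KontsevichZagierPeriods.Zeta5Search.CasoratianValuation (casoratian)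
open Summit.KontsevichZagierPeriods.Zeta5Search.CellKit (bLin)

/-- **Cell `c = 3`** (`(t+3)n < p ≤ (t+4)n`; `a = 3`, `N = 20`, R2 value `−13`): for all `t ≥ 5`, `n ≥ 1`,
`v_p(Cas₇(n·(3t+14; t+6,…,t))) ≥ −13`.  [THEOREM LB: `casLB = −13` on the whole cell.]  PROVED in `RuleRABFamilyCell3.lean`. -/
@[conjecture] def RuleR2ABCell3 : Prop :=
  ∀ t n p : ℕ, 5 ≤ t → 1 ≤ n → p.Prime → t * n + 3 * n < p → p ≤ t * n + 4 * n →
    casoratian (bLin (t * n) (t * n + 2 * n) n) 7 ≠ 0 →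
      (-13 : ℤ) ≤ padicValRat p (casoratian (bLin (t * n) (t * n + 2 * n) n) 7)

/-- **Cell `c = 4`** (`(t+4)n < p ≤ (t+5)n`; `a = 2`, `N = 19`, R2 value `−13`): for all `t ≥ 3`, `n ≥ 1`, `v_p(Cas₇) ≥ −13`.
[THEOREM LB.]  PROVED in `RuleRABFamilyCell4.lean`. -/
@[conjecture] def RuleR2ABCell4 : Prop :=
  ∀ t n p : ℕ, 3 ≤ t → 1 ≤ n → p.Prime → t * n + 4 * n < p → p ≤ t * n + 5 * n →
    casoratian (bLin (t * n) (t * n + 2 * n) n) 7 ≠ 0 →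
      (-13 : ℤ) ≤ padicValRat p (casoratian (bLin (t * n) (t * n + 2 * n) n) 7)

/-- **Cell `c = 5`** (`(t+5)n < p ≤ (t+6)n`; `a = 1`, `N = 17`, R2 value `−12`): for all `t ≥ 2`, `n ≥ 1`, `v_p(Cas₇) ≥ −12`.
[`casLB = −13`; the LEMMA-D BONUS gives `−12`.]  PROVED in `RuleRABFamilyCell5.lean`. -/
@[conjecture] def RuleR2ABCell5 : Prop :=
  ∀ t n p : ℕ, 2 ≤ t → 1 ≤ n → p.Prime → t * n + 5 * n < p → p ≤ t * n + 6 * n →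
    casoratian (bLin (t * n) (t * n + 2 * n) n) 7 ≠ 0 →
      (-12 : ℤ) ≤ padicValRat p (casoratian (bLin (t * n) (t * n + 2 * n) n) 7)

/-- **Cell `c = 6`** (`(t+6)n < p ≤ (t+7)n`; `a = 0`, `N = 15`, R2 value `−11`): for all `t ≥ 1`, `n ≥ 1`, `v_p(Cas₇) ≥ −11`.
[THEOREM LB.]  PROVED in `RuleRABFamilyCell6.lean`. -/
@[conjecture] def RuleR2ABCell6 : Prop :=
  ∀ t n p : ℕ, 1 ≤ t → 1 ≤ n → p.Prime → t * n + 6 * n < p → p ≤ t * n + 7 * n →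
    casoratian (bLin (t * n) (t * n + 2 * n) n) 7 ≠ 0 →
      (-11 : ℤ) ≤ padicValRat p (casoratian (bLin (t * n) (t * n + 2 * n) n) 7)

/-- **Top cell, the PROVABLE part** (`(t+2)n < p ≤ (t+3)n`; `a = 4`, `N = 21`): for all `t ≥ 7`, `n ≥ 1`, `v_p(Cas₇) ≥ −14`
[`casLB = −15`; the LEMMA-D BONUS gives `−14`; R2's value is `−13`].  PROVED in `RuleRABFamilyCell2.lean`. -/
@[conjecture] def RuleR2ABTopCellLB : Prop :=
  ∀ t n p : ℕ, 7 ≤ t → 1 ≤ n → p.Prime → t * n + 2 * n < p → p ≤ t * n + 3 * n →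
    casoratian (bLin (t * n) (t * n + 2 * n) n) 7 ≠ 0 →
      (-14 : ℤ) ≤ padicValRat p (casoratian (bLin (t * n) (t * n + 2 * n) n) 7)

/-- **Top cell, RULE R2's value — OBSERVED, NOT PROVED** (the one unit of rule R on this family that no tree law reaches; see the
module docstring for the 26 exact instances, all `= −13`, and the census scores): for all `t ≥ 7`, `n ≥ 1` and primes
`(t+2)n < p ≤ (t+3)n`, `v_p(Cas₇(n·(3t+14; t+6,…,t))) ≥ −13`.  For `t ≥ 15` this is the instance `a = 4`, `M(4) = {(1,4),(2,3)}` of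
`RuleR2Casoratian` on the family; its content beyond `RuleR2ABTopCellLB` is a second-digit cancellation in the Casoratian bracket. -/
@[conjecture] def RuleR2ABTopCell : Prop :=
  ∀ t n p : ℕ, 7 ≤ t → 1 ≤ n → p.Prime → t * n + 2 * n < p → p ≤ t * n + 3 * n →
    casoratian (bLin (t * n) (t * n + 2 * n) n) 7 ≠ 0 →
      (-13 : ℤ) ≤ padicValRat p (casoratian (bLin (t * n) (t * n + 2 * n) n) 7)

end Summit.KontsevichZagierPeriods.Zeta5Search.DenomLaw
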